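import Literature.MathematicalPhysics.QuantumFieldTheory.Balaban1983to89.B6Ineq2147TwoScaleV1B1

/-!
# `Balaban1983to89.B6Axial2121TwoScaleV1` — T. Bałaban, *Propagators and renormalization transformations for lattice gauge
# theories. II*, Commun. Math. Phys. **96** (1984) 223–250 [Balaban1984PropagatorsII], (2.121) p. 244 and (2.146) p. 248:
# **the block axial gauge of the concrete two-scale data IS the vanishing on the (centred) tree bonds** — `B ∈ Ax ⇔ B(b) = 0`
# for every bond `b` of a tree `Γ_y = ⋃_{x∈B(y)}Γ_{y,x}`, `y ∈ Λ′` — hence **the typed `B₁ = P_{Ax}Q″*B` IS the printed `B₁`**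
# (*"equal to Q″*B everywhere except the bonds of ⋃_{y∈Λ′}Ax(y) at which it is equal to 0"*)

statement-level skeleton of published theorems with citation tags; proofs where landed; nothing here is a claim about the Yang–Mills mass gap

PDF held: `paper:balaban1984-cmp96-propagators-rt-ii` (journal page = PDF page + 222; p. 244 [PDF 22], p. 248 [PDF 26] read,
materialised text `~/.lit/texts/…-rt-ii/p0022.txt`, `p0026.txt`); [Balaban1984PropagatorsI] (1.7), (1.10) pp. 18–19.

PRINT (verbatim).  p. 244: *"(we take a = 1) ‖B↾_{Λ^c}‖² + L^{−2}‖(Q₁B)↾_{Λ′}‖² + ⟨B, Δ_jB⟩ (2.120) on the configurations B satisfying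
B(b) = 0 for b ⊂ Γ_{y,x}, x ∈ B(y), y ∈ Λ′. (2.121)"*;  p. 248: *"… = ⟨B₁, C̃^{(j)}_ΛB₁⟩, (2.146) where B₁ is equal to Q″*B everywhere
except the bonds of ⋃_{y∈Λ′}Ax(y) at which it is equal to 0."*;  [B5] p. 18 (1.7): *"Γ_{y,x} = [y, (y₁, …, y_{d−1}, x_d)] ∪ … ∪
[(y₁, x₂, …, x_d), x]"*, p. 19 (1.10): *"A(Γ_{y,x}) = 0, x ∈ B(y), x ≠ y"*.

CITATION HEADER (lean-in-tree rule) — WHAT IS REPRODUCED.  Phase-2 file of the `lit-balaban` typed skeleton (HOME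
`run/shared/lean/pub/lit-balaban/`), seat **p22 gen 10** (B6 fold owner r03, referee ref-4; lane = the Sect. C chain (2.95)–(2.147) on the
concrete two-scale data).  SKELETON rows **B6.Eq2.120** ((2.120)–(2.122), a DEF row: the constraint (2.121)) and **B6.Eq2.144** ((2.146): the
object `B₁`).  Decls of record untouched (`…B6SectCTwoScaleV1.axial` = `Π_{y∈Λ′}δ_{Ax(y)}` by the staircase sums `stairSum` of
`LatticeFieldCalculus` from the block CENTRES `emb y` — the cell's centred convention DIVERGENCE F3; this seat's
`…B6Ineq2147TwoScaleV1B1.B1_lower` with `B₁ := P_{Ax}Q″*x`).  THIS FILE, for the unit lattice `T^{(j)}` of the V1 calculus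
(`j + 1 ≤ m + K`) and `Λ′ ⊂ T^{(j+1)}`:
* §1 `IsCentredTreeBond b` (DEFINITION with body, decidable): the positively oriented bond `b = ⟨z, z + e_μ⟩` lies on the tree
  `Γ_{y} = ⋃_{x∈B(y)}Γ_{y,x}` of ITS OWN block `B(y)`, `y` the centre: `z` has the centre's offset `(L−1)/2` in every direction `κ < μ`
  (the coordinates changed after `μ` along `Γ_{y,x}`) and is not on the far `μ`-face (offset `≠ L − 1`: the run of direction `μ` from the
  centre covers the offsets `0, …, L − 2` as sources);
* §2 the signed straight runs: `runSum_add_one` (one more step adds the next bond, for every signed length `n ∈ ℤ`);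
* §3 **(⇐) `stairSum_eq_zero_of_tree`**: every bond of `Γ_{emb y, x}`, `x ∈ B(y)`, is a centred tree bond of `B(y)`, so `A(Γ_{y,x}) = 0`
  when `A` vanishes on them; **`stairSum_blockSite_succ`**: for a tree bond `b = ⟨x, x + e_μ⟩`, `A(Γ_{y,x+e_μ}) = A(Γ_{y,x}) + A(b)`;
  **(⇒) `apply_eq_zero_of_stairSum_eq_zero`**; hence **`mem_axial_iff`: `B ∈ axial P j Λ′ ↔ B(b) = 0` for every centred tree bond
  `b` of a block `B(y)`, `y ∈ Λ′`** — the constraint (2.121) in the tree-bond form used on p. 248/249 (*"the bonds of ⋃Ax(y)"*,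
  *"We remove the variables B_b for b ⊂ Γ_{y,x}"*);
* §4 **`starProjection_axial_eq`**: the orthogonal projection onto the axial subspace is the coordinate restriction off the tree bonds;
  **`B1_eq_printed`**: the typed `B₁ = P_{Ax}Q″*x` of `…B6Ineq2147TwoScaleV1(B1)` EQUALS the printed `B₁`; **`printed_B1_lower`**:
  p. 248 *"‖B₁‖² is bounded from below by const‖B‖²"* with the printed `B₁`, `const = (2 + 4L² + L^{d+2})⁻¹`.
NEAREST ART: the CORNER-anchored tree bonds `…BalabanImbrieJaffe1984to88.BIJ88RenormTransf311.IsAxialBond` with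
`…BIJ85Eq34ContourForm.tree_iff_stairSum_corner_blockSite` (staircases from the block corner, [BIJ85] (3.4)), and on `Z^d`
`…B6BondElimination.IsTree`/`axial_iff`/`tree_iff_axial` (b2b cell) — the same dictionary for the other anchoring; not bridged.
ONE DEFINITION (`IsCentredTreeBond`, with body) + THEOREMS; no `def … : Prop` fact, standard axioms.  HONEST SCOPE: finite tori of the
V1 calculus, centred blocks (`L` odd); positively oriented bonds (the backward runs of `Γ_{y,x}` traverse positively oriented bonds with a
sign); NOT summit progress.
-/

noncomputable section

open scoped InnerProductSpace BigOperators

namespace Literature.MathematicalPhysics.QuantumFieldTheory.Balaban1983to89.B6Axial2121TwoScaleV1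

open LatticeFieldCalculus B6SectCTwoScaleV1

variable {P : Params} {j : ℕ}

/-! ## §1  The centred tree bonds -/

/-- **The bonds of the block trees `Γ_y = ⋃_{x∈B(y)} Γ_{y,x}` (centred blocks)**: the positively oriented bond `b = ⟨z, z + e_μ⟩` is a
bond of the tree of its own block iff the offsets of `z` in the directions `κ < μ` are the centre's `(L−1)/2` and its offset in the
direction `μ` is not `L − 1` ([B5] (1.7): along `Γ_{y,x}` the coordinates are changed in the order `d, …, 1`, each run starting from the
centre's coordinate).  The constraint (2.121) *"B(b) = 0 for b ⊂ Γ_{y,x}, x ∈ B(y), y ∈ Λ′"* is `B b = 0` for these `b` with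
`B(b₋) ∈ Λ′` (`mem_axial_iff`). [cite: Balaban1984PropagatorsII, (2.121) p.244] -/
def IsCentredTreeBond (b : PBond P j) : Prop :=
  (∀ κ : Fin P.d, κ < b.dir → (b.src κ).val % P.L = (P.L - 1) / 2) ∧ (b.src b.dir).val % P.L ≠ P.L - 1

/-- the tree-bond condition is decidable. [folklore] -/
instance instDecidablePredIsCentredTreeBond : DecidablePred (IsCentredTreeBond (P := P) (j := j)) := fun b => by
  unfold IsCentredTreeBond
  infer_instance

/-- unfolding. [cite: Balaban1984PropagatorsII, (2.121) p.244] -/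
theorem isCentredTreeBond_iff (b : PBond P j) : IsCentredTreeBond b ↔
    (∀ κ : Fin P.d, κ < b.dir → (b.src κ).val % P.L = (P.L - 1) / 2) ∧ (b.src b.dir).val % P.L ≠ P.L - 1 := Iff.rfl

/-! ## §2  Block points and signed straight runs -/

section Runs

variable {V : Type*} [AddCommGroup V]

/-- `2L ≤ N_j` in the standing range. [folklore] -/
private theorem two_mul_L_le_sitesPerDir (hj : j + 1 ≤ P.m + P.K) : 2 * P.L ≤ P.sitesPerDir j := by
  rw [P.sitesPerDir_eq_mul_succ hj]
  exact Nat.mul_le_mul_right _ (P.one_lt_sitesPerDir (j + 1))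

/-- the signed length of the `μ`-run of `Γ_{emb y, x}`, `x = (y, r)`: `r_μ − (L−1)/2`. [cite: Balaban1984PropagatorsI, (1.7) p.18] -/
private theorem valMinAbs_blockSite_sub_emb (hj : j + 1 ≤ P.m + P.K) (y : Site P (j + 1)) (r : Fin P.d → Fin P.L) (μ : Fin P.d) :
    ((Site.blockSite y r) μ - (emb y) μ).valMinAbs = ((r μ : ℕ) : ℤ) - (((P.L - 1) / 2 : ℕ) : ℤ) := by
  rw [ZMod.valMinAbs_spec]
  have hr := (r μ).isLt
  have hL : 1 < P.L := P.hL.2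
  have h2L := two_mul_L_le_sitesPerDir (P := P) hj
  have hh : (P.L - 1) / 2 < P.L := by omega
  have h2 : 2 * (P.L : ℤ) ≤ (P.sitesPerDir j : ℤ) := by exact_mod_cast h2L
  refine ⟨?_, ?_, ?_⟩
  · have e1 : (Site.blockSite y r) μ = (((y μ).val * P.L + r μ : ℕ) : ZMod (P.sitesPerDir j)) := rfl
    have e2 : (emb y) μ = (((y μ).val * P.L + (P.L - 1) / 2 : ℕ) : ZMod (P.sitesPerDir j)) := rfl
    rw [e1, e2, Int.cast_sub, Int.cast_natCast, Int.cast_natCast, Nat.cast_add, Nat.cast_add, add_sub_add_left_eq_sub]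
  · have h1 : (((P.L - 1) / 2 : ℕ) : ℤ) < (P.L : ℤ) := by exact_mod_cast hh
    have h3 : (0 : ℤ) ≤ ((r μ : ℕ) : ℤ) := Int.natCast_nonneg _
    linarith
  · have h1 : ((r μ : ℕ) : ℤ) < (P.L : ℤ) := by exact_mod_cast hr
    have h3 : (0 : ℤ) ≤ (((P.L - 1) / 2 : ℕ) : ℤ) := Int.natCast_nonneg _
    linarith

/-- the corner of `Γ_{emb y, x}`, `x = (y, r)`, at which the `μ`-run starts is the block point with offsets `r_ν` (`ν > μ`) and `(L−1)/2`
(`ν ≤ μ`). [cite: Balaban1984PropagatorsI, (1.7) p.18] -/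
private theorem mixSite_emb_blockSite (y : Site P (j + 1)) (r : Fin P.d → Fin P.L) (μ : Fin P.d) (h : (P.L - 1) / 2 < P.L) :
    mixSite μ (emb y) (Site.blockSite y r) = Site.blockSite y (fun ν => if μ < ν then r ν else ⟨(P.L - 1) / 2, h⟩) := by
  funext ν
  simp only [mixSite, Site.blockSite, emb]
  split_ifs <;> rfl

/-- the offset of a block point is its label modulo `L`. [folklore] -/
private theorem val_blockSite_mod (hj : j + 1 ≤ P.m + P.K) (y : Site P (j + 1)) (r : Fin P.d → Fin P.L) (κ : Fin P.d) :
    ((Site.blockSite y r) κ).val % P.L = r κ := by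
  rw [Site.val_blockSite hj, Nat.mul_add_mod_of_lt (r κ).isLt]

/-- moving `t` steps in the direction `μ` inside the block changes only the offset. [folklore] -/
private theorem runSite_blockSite_of_lt (y : Site P (j + 1)) (r : Fin P.d → Fin P.L) (μ : Fin P.d) (t : ℕ)
    (h : (r μ : ℕ) + t < P.L) :
    runSite (Site.blockSite y r) μ t = Site.blockSite y (Function.update r μ ⟨r μ + t, h⟩) := by
  funext ν
  by_cases hν : ν = μ
  · subst hν
    simp only [runSite, Function.update_self, Site.blockSite]
    push_cast
    ring
  · simp only [runSite, Function.update_of_ne hν, Site.blockSite]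

/-- moving `u ≤ r_μ` steps backwards in the direction `μ` inside the block changes only the offset. [folklore] -/
private theorem update_blockSite_sub (y : Site P (j + 1)) (r : Fin P.d → Fin P.L) (μ : Fin P.d) (u : ℕ) (h : u ≤ (r μ : ℕ)) :
    Function.update (Site.blockSite y r) μ ((Site.blockSite y r) μ - (u : ZMod (P.sitesPerDir j)))
      = Site.blockSite y (Function.update r μ ⟨(r μ : ℕ) - u, lt_of_le_of_lt (Nat.sub_le _ _) (r μ).isLt⟩) := by
  funext ν
  by_cases hν : ν = μ
  · rw [hν, Function.update_self]
    simp only [Site.blockSite, Function.update_self, Fin.val_mk]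
    have e : (y μ).val * P.L + (r μ : ℕ) = ((y μ).val * P.L + ((r μ : ℕ) - u)) + u := by omega
    rw [e, Nat.cast_add, add_sub_cancel_right]
  · rw [Function.update_of_ne hν]
    simp only [Site.blockSite, Function.update_of_ne hν]

/-- every fine site is a block point of its block (standing range). [folklore] -/
private theorem exists_blockSite_eq (hj : j + 1 ≤ P.m + P.K) (x : Site P j) :
    ∃ r : Fin P.d → Fin P.L, Site.blockSite (blockOf x) r = x :=
  ⟨Site.blockEquiv hj (blockOf x) ⟨x, rfl⟩, congrArg Subtype.val ((Site.blockEquiv hj (blockOf x)).left_inv ⟨x, rfl⟩)⟩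

/-- **one more step of a signed straight run adds the next bond**: `A(run of n+1 steps) = A(run of n steps) + A(⟨x + ne_μ, x + (n+1)e_μ⟩)`
for every `n ∈ ℤ` (for `n < 0` the bond `⟨x + ne_μ, x + (n+1)e_μ⟩` is positively oriented and was counted with a minus sign, which the
step removes). [cite: Balaban1984PropagatorsI, (1.7)–(1.8) pp.18–19] -/
theorem runSum_add_one (A : VecField P j V) (x : Site P j) (μ : Fin P.d) (n : ℤ) :
    runSum A x μ (n + 1) = runSum A x μ n + A ⟨Function.update x μ (x μ + (n : ZMod (P.sitesPerDir j))), μ⟩ := by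
  cases n with
  | ofNat k =>
    rw [Int.ofNat_eq_natCast, ← Nat.cast_succ, runSum_ofNat, runSum_ofNat, segSum, segSum, Finset.sum_range_succ, Int.cast_natCast]
    rfl
  | negSucc k =>
    have hk : runSum A x μ (Int.negSucc k) =
        -∑ t ∈ Finset.range (k + 1), A ⟨Function.update x μ (x μ - ((t + 1 : ℕ) : ZMod (P.sitesPerDir j))), μ⟩ := rfl
    cases k with
    | zero =>
      have e : Int.negSucc 0 + 1 = 0 := by decide
      rw [e, runSum_zero, hk, Int.cast_negSucc, ← sub_eq_add_neg, Finset.sum_range_succ, Finset.sum_range_zero, zero_add,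
        neg_add_cancel]
    | succ k =>
      have hk' : runSum A x μ (Int.negSucc k) =
          -∑ t ∈ Finset.range (k + 1), A ⟨Function.update x μ (x μ - ((t + 1 : ℕ) : ZMod (P.sitesPerDir j))), μ⟩ := rfl
      have e : Int.negSucc (k + 1) + 1 = Int.negSucc k := by
        rw [Int.negSucc_eq, Int.negSucc_eq]; push_cast; ring
      rw [e, hk', hk, Int.cast_negSucc, ← sub_eq_add_neg, Finset.sum_range_succ _ (k + 1)]
      abel

end Runs

/-! ## §3  The staircases consist of centred tree bonds, and each tree bond ends a staircase -/

section Stair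

variable {V : Type*} [AddCommGroup V]

/-- **(⇐) every bond of `Γ_{y,x}`, `x ∈ B(y)`, is a centred tree bond of `B(y)`**: so `A(Γ_{y,x}) = 0` whenever `A` vanishes on the
centred tree bonds starting in `B(y)`. [cite: Balaban1984PropagatorsI, (1.7)+(1.10) pp.18–19] -/
theorem stairSum_eq_zero_of_tree (hj : j + 1 ≤ P.m + P.K) (A : VecField P j V) (y : Site P (j + 1)) (r : Fin P.d → Fin P.L)
    (hA : ∀ b : PBond P j, blockOf b.src = y → IsCentredTreeBond b → A b = 0) :
    stairSum A (emb y) (Site.blockSite y r) = 0 := by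
  have hL : 1 < P.L := P.hL.2
  obtain ⟨l, hl⟩ := P.hL.1
  have hh : (P.L - 1) / 2 < P.L := by omega
  unfold stairSum
  refine Finset.sum_eq_zero fun μ _ => ?_
  obtain ⟨r', hr'μ, hr'lt, hmix⟩ : ∃ r' : Fin P.d → Fin P.L, (r' μ : ℕ) = (P.L - 1) / 2 ∧
      (∀ κ, κ < μ → (r' κ : ℕ) = (P.L - 1) / 2) ∧ mixSite μ (emb y) (Site.blockSite y r) = Site.blockSite y r' :=
    ⟨fun ν => if μ < ν then r ν else ⟨(P.L - 1) / 2, hh⟩, by simp, fun κ hκ => by simp [not_lt.2 hκ.le], mixSite_emb_blockSite y r μ hh⟩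
  rw [hmix, valMinAbs_blockSite_sub_emb hj]
  have hr := (r μ).isLt
  rcases le_or_gt ((P.L - 1) / 2) (r μ : ℕ) with hle | hgt
  · -- forward run: sources at offsets `(L−1)/2 + t`, `t < r_μ − (L−1)/2`
    obtain ⟨n, hn⟩ : ∃ n : ℕ, (r μ : ℕ) = (P.L - 1) / 2 + n := ⟨(r μ : ℕ) - (P.L - 1) / 2, by omega⟩
    have hcast : ((r μ : ℕ) : ℤ) - (((P.L - 1) / 2 : ℕ) : ℤ) = ((n : ℕ) : ℤ) := by rw [hn]; push_cast; ring
    rw [hcast, runSum_ofNat, segSum]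
    refine Finset.sum_eq_zero fun t ht => ?_
    rw [Finset.mem_range] at ht
    have hin : (r' μ : ℕ) + t < P.L := by rw [hr'μ]; omega
    have hsrc : runSite (Site.blockSite y r') μ t = Site.blockSite y (Function.update r' μ ⟨r' μ + t, hin⟩) :=
      runSite_blockSite_of_lt y r' μ t hin
    apply hA
    · show blockOf (runSite (Site.blockSite y r') μ t) = y
      rw [hsrc, Site.blockOf_blockSite hj]
    · refine ⟨fun κ hκ => ?_, ?_⟩
      · have hκ' : κ < μ := hκ
        show ((runSite (Site.blockSite y r') μ t) κ).val % P.L = (P.L - 1) / 2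
        rw [hsrc, val_blockSite_mod hj, Function.update_of_ne hκ'.ne]
        exact hr'lt κ hκ'
      · show ((runSite (Site.blockSite y r') μ t) μ).val % P.L ≠ P.L - 1
        rw [hsrc, val_blockSite_mod hj, Function.update_self, Fin.val_mk, hr'μ]
        omega
  · -- backward run: sources at offsets `(L−1)/2 − (t+1)`, `t < (L−1)/2 − r_μ`
    obtain ⟨n, hn⟩ : ∃ n : ℕ, (P.L - 1) / 2 = (r μ : ℕ) + (n + 1) := ⟨(P.L - 1) / 2 - (r μ : ℕ) - 1, by omega⟩
    have hcast : ((r μ : ℕ) : ℤ) - (((P.L - 1) / 2 : ℕ) : ℤ) = Int.negSucc n := by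
      rw [hn, Int.negSucc_eq]; push_cast; ring
    rw [hcast]
    show -(∑ t ∈ Finset.range (n + 1),
      A ⟨Function.update (Site.blockSite y r') μ
        ((Site.blockSite y r') μ - ((t + 1 : ℕ) : ZMod (P.sitesPerDir j))), μ⟩) = 0
    rw [neg_eq_zero]
    refine Finset.sum_eq_zero fun t ht => ?_
    rw [Finset.mem_range] at ht
    have ht1 : t + 1 ≤ (r' μ : ℕ) := by rw [hr'μ]; omega
    rw [update_blockSite_sub y r' μ (t + 1) ht1]
    apply hA
    · exact Site.blockOf_blockSite hj y _
    · refine ⟨fun κ hκ => ?_, ?_⟩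
      · have hκ' : κ < μ := hκ
        show ((Site.blockSite y (Function.update r' μ ⟨(r' μ : ℕ) - (t + 1), _⟩)) κ).val % P.L = (P.L - 1) / 2
        rw [val_blockSite_mod hj, Function.update_of_ne hκ'.ne]
        exact hr'lt κ hκ'
      · show ((Site.blockSite y (Function.update r' μ ⟨(r' μ : ℕ) - (t + 1), _⟩)) μ).val % P.L ≠ P.L - 1
        rw [val_blockSite_mod hj, Function.update_self, Fin.val_mk, hr'μ]
        omega

/-- **one more tree bond lengthens the staircase by that bond**: for `x = (y, r) ∈ B(y)` with the centre's offsets in the directions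
`κ < μ` and `r_μ + 1 < L`, `A(Γ_{y, x + e_μ}) = A(Γ_{y,x}) + A(⟨x, x + e_μ⟩)` (the runs of directions `> μ` agree, those of directions
`< μ` are empty, the `μ`-run gains the bond). [cite: Balaban1984PropagatorsI, (1.7)+(1.10) pp.18–19] -/
theorem stairSum_blockSite_succ (hj : j + 1 ≤ P.m + P.K) (A : VecField P j V) (y : Site P (j + 1)) (r : Fin P.d → Fin P.L)
    (μ : Fin P.d) (hlt : (r μ : ℕ) + 1 < P.L) (hctr : ∀ κ : Fin P.d, κ < μ → (r κ : ℕ) = (P.L - 1) / 2) :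
    stairSum A (emb y) (Site.blockSite y (Function.update r μ ⟨r μ + 1, hlt⟩)) =
      stairSum A (emb y) (Site.blockSite y r) + A ⟨Site.blockSite y r, μ⟩ := by
  have hL : 1 < P.L := P.hL.2
  have hh : (P.L - 1) / 2 < P.L := by omega
  set r₂ : Fin P.d → Fin P.L := Function.update r μ ⟨r μ + 1, hlt⟩ with hr₂
  have hr₂ne : ∀ κ, κ ≠ μ → r₂ κ = r κ := fun κ hκ => by rw [hr₂, Function.update_of_ne hκ]
  have hr₂μ : (r₂ μ : ℕ) = (r μ : ℕ) + 1 := by rw [hr₂, Function.update_self]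
  have hxκ : ∀ κ, κ ≠ μ → Site.blockSite y r₂ κ = Site.blockSite y r κ := fun κ hκ => by
    simp only [Site.blockSite, hr₂ne κ hκ]
  unfold stairSum
  rw [← Finset.sum_erase_add _ _ (Finset.mem_univ μ), ← Finset.sum_erase_add _ _ (Finset.mem_univ μ), add_assoc]
  congr 1
  · refine Finset.sum_congr rfl fun κ hκ => ?_
    have hκμ : κ ≠ μ := Finset.ne_of_mem_erase hκ
    rcases lt_or_gt_of_ne hκμ with hκlt | hκgt
    · -- `κ < μ`: both runs are empty
      have h0 : ∀ r' : Fin P.d → Fin P.L, (r' κ : ℕ) = (P.L - 1) / 2 →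
          ((Site.blockSite y r') κ - (emb y) κ).valMinAbs = 0 := by
        intro r' h
        rw [valMinAbs_blockSite_sub_emb hj, h, sub_self]
      have h1 : (r₂ κ : ℕ) = (P.L - 1) / 2 := by rw [hr₂ne κ hκμ]; exact hctr κ hκlt
      rw [h0 r₂ h1, h0 r (hctr κ hκlt), runSum_zero, runSum_zero]
    · -- `μ < κ`: the same run
      have hmix : mixSite κ (emb y) (Site.blockSite y r₂) = mixSite κ (emb y) (Site.blockSite y r) := by
        funext ν
        simp only [mixSite]
        split_ifs with hν
        · exact hxκ ν (ne_of_gt (hκgt.trans hν))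
        · rfl
      rw [hmix, hxκ κ hκμ]
  · -- `κ = μ`: the same start, one more step
    have hmix : mixSite μ (emb y) (Site.blockSite y r₂) = mixSite μ (emb y) (Site.blockSite y r) := by
      funext ν
      simp only [mixSite]
      split_ifs with hν
      · exact hxκ ν (ne_of_gt hν)
      · rfl
    rw [hmix, valMinAbs_blockSite_sub_emb hj, valMinAbs_blockSite_sub_emb hj, hr₂μ, Nat.cast_add, Nat.cast_one,
      show ((r μ : ℕ) : ℤ) + 1 - (((P.L - 1) / 2 : ℕ) : ℤ) = (((r μ : ℕ) : ℤ) - (((P.L - 1) / 2 : ℕ) : ℤ)) + 1 by ring,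
      runSum_add_one]
    congr 2
    -- the added bond is `⟨x, μ⟩`
    rw [mixSite_emb_blockSite y r μ hh]
    congr 1
    set m : ℕ := (P.L - 1) / 2 with hm
    funext ν
    by_cases hν : ν = μ
    · rw [hν, Function.update_self]
      simp only [Site.blockSite, lt_irrefl, if_false, Fin.val_mk]
      rw [Int.cast_sub, Int.cast_natCast, Int.cast_natCast, Nat.cast_add, Nat.cast_add]
      ring
    · rw [Function.update_of_ne hν]
      simp only [Site.blockSite]
      split_ifs with h1
      · rfl
      · rw [Fin.val_mk, hctr ν (lt_of_le_of_ne (not_lt.mp h1) hν)]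

/-- **(⇒) a bond field with vanishing staircase sums `A(Γ_{y,x})`, `x ∈ B(y)`, vanishes on the centred tree bonds of `B(y)`**.
[cite: Balaban1984PropagatorsI, (1.10) p.19] -/
theorem apply_eq_zero_of_stairSum_eq_zero (hj : j + 1 ≤ P.m + P.K) (A : VecField P j V) (y : Site P (j + 1))
    (hS : ∀ r : Fin P.d → Fin P.L, stairSum A (emb y) (Site.blockSite y r) = 0) (b : PBond P j) (hb : blockOf b.src = y)
    (ht : IsCentredTreeBond b) : A b = 0 := by
  obtain ⟨r, hr⟩ := exists_blockSite_eq hj b.src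
  rw [hb] at hr
  have hrκ : ∀ κ, (r κ : ℕ) = (b.src κ).val % P.L := fun κ => by rw [← hr, val_blockSite_mod hj]
  have hlt : (r b.dir : ℕ) + 1 < P.L := by
    have h1 := ht.2
    have h2 := (r b.dir).isLt
    rw [← hrκ] at h1
    omega
  have hctr : ∀ κ : Fin P.d, κ < b.dir → (r κ : ℕ) = (P.L - 1) / 2 := fun κ hκ => by rw [hrκ]; exact ht.1 κ hκ
  have key := stairSum_blockSite_succ hj A y r b.dir hlt hctr
  rw [hS, hS, zero_add] at key
  have hb' : (⟨Site.blockSite y r, b.dir⟩ : PBond P j) = b := by rw [hr]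
  rw [← hb']
  exact key.symm

variable (Λ' : Finset (Site P (j + 1)))

/-- **(2.121) ⇔ the block axial gauge**: `B ∈ axial P j Λ′` (all staircase sums `B(Γ_{y,x})`, `x ∈ B(y)`, `y ∈ Λ′`, vanish) iff
*"B(b) = 0 for b ⊂ Γ_{y,x}, x ∈ B(y), y ∈ Λ′"* — `B b = 0` for every centred tree bond `b` starting in `B(Λ′)`.
[cite: Balaban1984PropagatorsII, (2.121) p.244] -/
theorem mem_axial_iff (hj : j + 1 ≤ P.m + P.K) (B : UBond P j) :
    B ∈ axial P j Λ' ↔ ∀ b : PBond P j, blockOf b.src ∈ Λ' → IsCentredTreeBond b → B b = 0 := by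
  constructor
  · intro h b hb ht
    exact apply_eq_zero_of_stairSum_eq_zero hj (WithLp.ofLp B) (blockOf b.src) (fun r => (mem_axial j Λ' B).1 h _ hb r) b rfl ht
  · intro h
    exact (mem_axial j Λ' B).2 fun Y hY r =>
      stairSum_eq_zero_of_tree hj (WithLp.ofLp B) Y r fun b hb ht => h b (by rw [hb]; exact hY) ht

end Stair

/-! ## §4  `P_{Ax}` is the restriction off the tree bonds: the typed `B₁` is the printed `B₁` -/

section Proj

variable (Λ' : Finset (Site P (j + 1)))

/-- **the orthogonal projection onto the axial subspace is the coordinate restriction off the tree bonds of `B(Λ′)`**.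
[cite: Balaban1984PropagatorsII, (2.146) p.248] -/
theorem starProjection_axial_eq (hj : j + 1 ≤ P.m + P.K) (v : UBond P j) :
    (axial P j Λ').starProjection v =
      WithLp.toLp 2 (fun b => if blockOf b.src ∈ Λ' ∧ IsCentredTreeBond b then 0 else v b) := by
  apply Submodule.eq_starProjection_of_mem_of_inner_eq_zero
  · rw [mem_axial_iff Λ' hj]
    intro b hb ht
    show (if blockOf b.src ∈ Λ' ∧ IsCentredTreeBond b then (0 : ℝ) else v b) = 0
    rw [if_pos ⟨hb, ht⟩]
  · intro w hw
    rw [mem_axial_iff Λ' hj] at hw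
    rw [PiLp.inner_apply]
    refine Finset.sum_eq_zero fun b _ => ?_
    show ⟪v b - (if blockOf b.src ∈ Λ' ∧ IsCentredTreeBond b then (0 : ℝ) else v b), w b⟫_ℝ = 0
    by_cases h : blockOf b.src ∈ Λ' ∧ IsCentredTreeBond b
    · rw [if_pos h, hw b h.1 h.2, inner_zero_right]
    · rw [if_neg h, sub_self, inner_zero_left]

/-- **the typed `B₁ = P_{Ax}Q″*x` IS the printed `B₁`** — *"equal to Q″*B everywhere except the bonds of ⋃_{y∈Λ′}Ax(y) at which it
is equal to 0"*. [cite: Balaban1984PropagatorsII, (2.146) p.248] -/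
theorem B1_eq_printed (hj : j + 1 ≤ P.m + P.K) (x : CSpace j Λ') :
    (axial P j Λ').starProjection (LinearMap.adjoint (Qpp P j Λ') x) =
      WithLp.toLp 2 (fun b => if blockOf b.src ∈ Λ' ∧ IsCentredTreeBond b then 0
        else LinearMap.adjoint (Qpp P j Λ') x b) :=
  starProjection_axial_eq Λ' hj _

/-- **p. 248 *"‖B₁‖² is bounded from below by const‖B‖²"* WITH THE PRINTED `B₁`** (`Q″*x` off the tree bonds of `B(Λ′)`, `0` on
them): `(2 + 4L² + L^{d+2})⁻¹‖x‖² ≤ ‖B₁‖²` (this seat's `…B6Ineq2147TwoScaleV1B1.B1_lower` + `B1_eq_printed`).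
[cite: Balaban1984PropagatorsII, (2.147) p.248] -/
theorem printed_B1_lower (hj : j + 1 ≤ P.m + P.K) (x : CSpace j Λ') :
    (2 + 4 * (P.L : ℝ) ^ 2 + (P.L : ℝ) ^ (P.d + 2))⁻¹ * ‖x‖ ^ 2 ≤
      ∑ b : PBond P j, (if blockOf b.src ∈ Λ' ∧ IsCentredTreeBond b then 0
        else LinearMap.adjoint (Qpp P j Λ') x b) ^ 2 := by
  have h := B6Ineq2147TwoScaleV1B1.B1_lower hj Λ' x
  have e : ‖WithLp.toLp 2 (fun b : PBond P j => if blockOf b.src ∈ Λ' ∧ IsCentredTreeBond b then (0 : ℝ)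
      else LinearMap.adjoint (Qpp P j Λ') x b)‖ ^ 2 =
      ∑ b : PBond P j, (if blockOf b.src ∈ Λ' ∧ IsCentredTreeBond b then 0 else LinearMap.adjoint (Qpp P j Λ') x b) ^ 2 := by
    rw [EuclideanSpace.real_norm_sq_eq]
  rw [B1_eq_printed Λ' hj, e] at h
  exact h

end Proj

/-! ## §5  For `tsV1` -/

section TwoScale

open B6SectCTwoScaleV1Lattice

variable {c : ℝ} (hc : c ≠ 0) (hj : j + 1 ≤ P.m + P.K) (Λ' : Finset (Site P (j + 1))) (w : CIdx j Λ' → ℝ)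

include hj in
/-- (2.121) for the data `tsV1`: its axial subspace `Ax` is cut out by `B(b) = 0` on the centred tree bonds of `B(Λ′)`.
[cite: Balaban1984PropagatorsII, (2.121) p.244] -/
theorem mem_Ax_tsV1_iff (B : UBond P j) :
    B ∈ (tsV1 hc Λ' w).Ax ↔ ∀ b : PBond P j, blockOf b.src ∈ Λ' → IsCentredTreeBond b → B b = 0 :=
  mem_axial_iff Λ' hj B

include hj in
/-- the `B₁` of (2.146) for `tsV1` is the printed one. [cite: Balaban1984PropagatorsII, (2.146) p.248] -/
theorem B1_tsV1_eq_printed (x : CSpace j Λ') :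
    (tsV1 hc Λ' w).Ax.starProjection (LinearMap.adjoint (tsV1 hc Λ' w).Qpp x) =
      WithLp.toLp 2 (fun b => if blockOf b.src ∈ Λ' ∧ IsCentredTreeBond b then 0
        else LinearMap.adjoint (Qpp P j Λ') x b) :=
  B1_eq_printed Λ' hj x

end TwoScale

end Literature.MathematicalPhysics.QuantumFieldTheory.Balaban1983to89.B6Axial2121TwoScaleV1

end
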